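import Summits.BirchSwinnertonDyer.BirchSwinnertonDyer.Theorems.GenusKolyvaginAtTwoGenusPrimitiveSupplyAtTwoTwistUnramifiedMenu
import Summits.BirchSwinnertonDyer.BirchSwinnertonDyer.Theorems.GenusKolyvaginAtTwoShaCardDvdPowAtTwoRTRankQ
import Summits.BirchSwinnertonDyer.BirchSwinnertonDyer.Theorems.GenusKolyvaginAtTwoGenusPrimitiveSupplyAtTwoTwistingPrimeEntangledStrict
import Summits.BirchSwinnertonDyer.BirchSwinnertonDyer.Theorems.GenusKolyvaginAtTwoGenusPrimitiveSupplyAtTwoTwistSelmerTransferDownRat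
import Summits.BirchSwinnertonDyer.BirchSwinnertonDyer.Theorems.GenusKolyvaginAtTwoGenusPrimitiveSupplyAtTwoArchimedeanEgg
import HarnessLib

/-!
# Route `GenusKolyvaginAtTwo`, crux `GenusDeepSupplyAtTwoNegDiscNarrow` (stmt-BirchSwinnertonDyer-23491, Δ < 0):
# CLAIM B of the LEAD's DEPTH-ZERO REDUCTION CRITERION — on the `#Sel₂(E) = 1` cell EVERY non-zero `2`-Selmer class of the
# Heegner twin is NON-STRICT at the transposition prime, so a twin point outside `2·Wd(ℚ)` is not halvable in `Wd(ℚ_{ℓ₀})`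

Width seat `bsd-line-gk2-p4` g25 (cell `bsd-f1-sign2`), `--supports stmt-BirchSwinnertonDyer-23491` (helper; closes nothing).
THEOREMS ONLY (no definition, no named fact, no `sorry`); **BSD is NOT proved by any of this; no item is closed.**

CONTEXT. The LEAD (gk2-p1 g21, `Cruxes/…/DEPTH-ZERO-REDUCTION-CRITERION-g21.md`) isolated the beyond-print kernel K₁ of the Δ<0
supply crux on the `#Sel₂(E) = 1` cell as «`M₀ = 0`: the Heegner point `y_K` is `2`-primitive», and gave a REDUCTION BIT R₁ at a good
prime `ℓ₀ ∣ d_K` with Claim A «R₁ ⟹ K₁» (landed: p761607 kernel, gk2-p5 g33 p762289/p762355 instantiation) and Claim B «K₁ ⟹ R₁ on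
`#Sel₂(E) = 1`» (its §2, listed OPEN by g33). In TWIN currency (`Wd ≅ E^{(d_K)}`, `Wd(ℚ) ≅ E(K)⁻`, the twin point `z ↔ y_K − s`) Claim A
is the triviality «`z ∈ 2Wd(ℚ) ⟹ z ∈ 2Wd(ℚ_{ℓ₀})`» and Claim B is the GLOBAL statement proved here:

* §1 (any number field, `p = 2`, twist pair `(E, E^{(d)})`, one finite place `v₀`, the lineage's FIVE-row place menu off `v₀`)
  `exists_intertwining_twin_selmer_map_mem_of_localization_eq_zero_of_menu₅` — ONE identification `φ : E^{(d)}[2] ≅ E[2]` such that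
  every class `c ∈ Sel₂(E^{(d)})` with `loc_{v₀} c = 0` has `H¹(φ) c ∈ Sel₂(E)` (class-level transport `H¹_{φ_*𝓚} ⊂ Sel^{v₀}`,
  `GenusKolyTwistingPrime.map_mem_selmer_of_localization_eq_zero`, with the agreement off `v₀` from the menu); hence
  `twin_selmer_eq_zero_of_localization_eq_zero_of_natCard_eq_one_of_menu₅`: **`#Sel₂(E) = 1` ⟹ the strict-at-`v₀` part of
  `Sel₂(E^{(d)})` is zero.**
* §2 (`ℚ`, `W` globally minimal, `Δ_W < 0`, `K` quadratic with odd `d_K`, Heegner for `N_W`, `v₀` a finite place, every prime of `d_K`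
  off `v₀` SILENT for `W` and `Wd`; menu = gk2-p1's `twist_place_menu₅_finite_rat_of_silent` + `twist_place_menu_infinite_rat`):
  `twin_selmer_eq_zero_of_localization_eq_zero_of_selmerTrivial` (`#Sel₂(W) = 1`, `c ∈ Sel₂(Wd)`, `loc_{v₀} c = 0 ⟹ c = 0`),
  `twin_selmer_localization_ne_zero_of_selmerTrivial` (`c ≠ 0 ⟹ loc_{v₀} c ≠ 0`), and the POINT form
  `not_exists_two_smul_completion_of_kummer_ne_zero_of_selmerTrivial`: **`κ(P) ≠ 0` (`P ∈ Wd(ℚ) ∖ 2Wd(ℚ)`) ⟹ `P ∉ 2·Wd(ℚ_{v₀})`**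
  (`κ(P) ∈ Sel₂(Wd)`, `loc_{v₀} κ(P) = 0 ⟺ P ∈ 2Wd(ℚ_{v₀})` — tree `localization_kummerMapTorsion_eq_zero_iff`), with the iff packaging
  `exists_two_smul_completion_iff_kummer_eq_zero_of_selmerTrivial`; the generic point form (`P ∉ 2V(K)`, any number field, one
  `DecidableEq` instance) is §1's `not_exists_two_smul_completion_of_forall_selmer_eq_zero`.
* §3 the PRIME Heegner field `d_K = −ℓ` (the supply's `ℓ ≡ 7 (8)` fields; silence off `ℓ` is vacuous), also in Mazur–Rubin's
  `strictLocalKer` currency: `twin_selmer_eq_zero_of_mem_strictLocalKer_of_selmerTrivial_prime`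
  (`Sel₂(Wd) ⊓ strictLocalKer Wd ℚ_ℓ 2 = ⊥`), `not_exists_two_smul_completion_of_kummer_ne_zero_of_selmerTrivial_prime`.

READING for the cell (numbers in the LEAD memo §3): on the `#Sel₂(E) = 1` cell the two observables of instrument I1 — «the twin's
point `z` is `2`-saturated» and «`z ∉ 2Wd(ℚ_{ℓ₀})` (= singular reduction at the twisting prime, LEAD §2)» — are EQUIVALENT; with Claim A
the reduction bit R₁ is therefore NECESSARY as well as sufficient for K₁ modulo the local dictionary at `λ₀` (not in this file).
Unconditional (no print fact: no Poitou–Tate, no parity). The Δ>0 crux 25504 is NOT covered: there the real place is off the menu.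

References: [MazurRubin2010] B. Mazur, K. Rubin, Invent. Math. 181 (2010), Def. 3.1, Lemma 2.10, Prop. 3.3 (first display of the
proof), Cor. 3.4 (i); [GrossLMS1991] §1; [Kramer1981] Prop. 3, Prop. 7; [SilvermanAEC2009] VIII §2, X §4.
-/

set_option linter.dupNamespace false -- tree convention: `Summit.BirchSwinnertonDyer.BirchSwinnertonDyer.Theorems` (summit = sub-problem)
set_option autoImplicit false

noncomputable section

open scoped Classical ContRepresentation

namespace Summit.BirchSwinnertonDyer.BirchSwinnertonDyer.Theorems.GenusSupplyNarrow.DepthZero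

open WeierstrassCurve Field NumberField IsDedekindDomain Function
open Literature.NumberTheory.EllipticCurves Literature.NumberTheory.GaloisRepresentations
open Literature.NumberTheory.GaloisRepresentations.IsNonarchimedeanLocalField (maxUnramified)
open Literature.NumberTheory.GaloisRepresentations.DiscreteGaloisModule (SelmerStructure)
open Literature.NumberTheory.GaloisCohomology
open Summit.BirchSwinnertonDyer.Rank1Residual.X11b.CongruentTransfer
open Summit.BirchSwinnertonDyer.Rank1Residual.X11b.Levels (map_map_eq_self_of_comp_eq)
open Rat.HeightOneSpectrum (primesEquiv natGenerator)
open Summit.BirchSwinnertonDyer.BirchSwinnertonDyer.Theorems.GenusKolyArch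
  (exists_intertwining_hsplit_and_unramified transport_twist_agree_inr_of_menu₅ localization_kummerMapTorsion_eq_zero_iff hdiv_two)
open Summit.BirchSwinnertonDyer.BirchSwinnertonDyer.Theorems.GenusKolyTwistTamagawa (transport_twist_agree_inl_of_menu)
open Summit.BirchSwinnertonDyer.BirchSwinnertonDyer.Theorems.GenusKolyTwistLocal (twist_place_menu_infinite_rat)
open Summit.BirchSwinnertonDyer.BirchSwinnertonDyer.Theorems.GenusKolyTwistingPrime
  (map_mem_selmer_of_localization_eq_zero localization_eq_zero_of_mem_strictLocalKer primesEquiv_eq)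
open Summit.BirchSwinnertonDyer.BirchSwinnertonDyer.Theorems.GenusExact.PlusDescent (twist_place_menu₅_finite_rat_of_silent)

/-! ## §1 Class-level transport twin → curve off one place, on the five-row menu (any number field) -/

section Menu

variable {K : Type} [Field K] [NumberField K] (W : WeierstrassCurve K) [W.IsElliptic]

/-- **STRICT TWIN CLASSES TRANSPORT INTO `Sel₂(E)`.** `W` elliptic over a number field `K`, `d ≠ 0`, `Wd` any elliptic model of
`W^{(d)}`, `v₀` a finite place; every finite `v ≠ v₀` on the five-row menu (split ∨ odd with odd Tamagawa numbers ∨ odd both good ∨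
odd both silent ∨ unramified-in-`K(√d)` with `W` good or multiplicative-odd) and every infinite place split or with
`H¹(K_w, W) = 0 = H¹(K_w, Wd)`. THEN there are inverse `Γ_K`-intertwinings `φ : Wd[2] ⇄ W[2] : ψ` such that every
`c ∈ Sel₂(Wd)` with `loc_{v₀} c = 0` has `H¹(φ) c ∈ Sel₂(W)` with `loc_{v₀} (H¹(φ) c) = 0` — the inclusion `S_T ⊂ Sel₂` of the first
display of Mazur–Rubin's proof of Prop. 3.3 with `T = {v₀}`, read from the twist to the curve. No duality, nothing assumed at `v₀`.
[cite: MazurRubin2010, Lemma 2.10, Def. 3.1, Prop. 3.3 (first display of the proof) (arXiv:0904.3709 pp. 8–10)] -/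
theorem exists_intertwining_twin_selmer_map_mem_of_localization_eq_zero_of_menu₅
    {d : K} (hd : d ≠ 0) {Wd : WeierstrassCurve K} [Wd.IsElliptic] {C : VariableChange K}
    (hWd : C • W.quadraticTwist d = Wd) (v₀ : HeightOneSpectrum (𝓞 K))
    (hfin : ∀ v : HeightOneSpectrum (𝓞 K), v ≠ v₀ →
      (∃ s : v.adicCompletion K, s ^ 2 = algebraMap K (v.adicCompletion K) d) ∨
      (((2 : ℕ) : 𝓞 K) ∉ v.asIdeal ∧
        ¬ 2 ∣ (W.baseChange (v.adicCompletion K)).localTamagawaNumber (v.adicCompletionIntegers K) ∧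
        ¬ 2 ∣ (Wd.baseChange (v.adicCompletion K)).localTamagawaNumber (v.adicCompletionIntegers K)) ∨
      (((2 : ℕ) : 𝓞 K) ∉ v.asIdeal ∧ W.HasGoodReductionAt v ∧ Wd.HasGoodReductionAt v) ∨
      (((2 : ℕ) : 𝓞 K) ∉ v.asIdeal ∧
        Nat.card (nsmulAddMonoidHom 2 : (W.baseChange (v.adicCompletion K)).toAffine.Point →+ _).ker = 1 ∧
        Nat.card (nsmulAddMonoidHom 2 : (Wd.baseChange (v.adicCompletion K)).toAffine.Point →+ _).ker = 1) ∨
      ((W.HasGoodReductionAt v ∨ (W.HasMultiplicativeReductionAt v ∧ Odd (W.ordMinimalDiscriminant v))) ∧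
        closureEmb (K := K) (v.adicCompletion K) (geomSqrt d) ∈ maxUnramified (v.adicCompletion K)))
    (hinf : ∀ w : InfinitePlace K,
      (∃ s : w.Completion, s ^ 2 = algebraMap K w.Completion d) ∨
      ((∀ x : galoisCohomology (W.localGaloisModule w.Completion) 1, x = 0) ∧
        (∀ x : galoisCohomology (Wd.localGaloisModule w.Completion) 1, x = 0))) :
    ∃ (φ : (Wd.torsionGaloisModule ((2 : ℕ) : ℤ)).toContRepresentation →ⁱL
        (W.torsionGaloisModule ((2 : ℕ) : ℤ)).toContRepresentation)
      (ψ : (W.torsionGaloisModule ((2 : ℕ) : ℤ)).toContRepresentation →ⁱL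
        (Wd.torsionGaloisModule ((2 : ℕ) : ℤ)).toContRepresentation),
      (∀ a, ψ (φ a) = a) ∧ (∀ b, φ (ψ b) = b) ∧
      ∀ c ∈ (Wd.kummerSelmerStructure ((2 : ℕ) : ℤ)).selmerGroup,
        galoisCohomology.localization (Wd.torsionGaloisModule ((2 : ℕ) : ℤ)) (Sum.inr v₀) 1 c = 0 →
        galoisCohomology.map φ 1 c ∈ (W.kummerSelmerStructure ((2 : ℕ) : ℤ)).selmerGroup ∧
          galoisCohomology.localization (W.torsionGaloisModule ((2 : ℕ) : ℤ)) (Sum.inr v₀) 1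
            (galoisCohomology.map φ 1 c) = 0 := by
  haveI : Fact (Nat.Prime 2) := ⟨Nat.prime_two⟩
  obtain ⟨φ, ψ, hψφ, hφψ, hsplit, hunr⟩ := exists_intertwining_hsplit_and_unramified W Wd hd hWd
  -- the transported Kummer structure of `Wd` on `W[2]`
  let 𝓐 : SelmerStructure (W.torsionGaloisModule ((2 : ℕ) : ℤ)) := fun v ↦
    (Wd.kummerSelmerStructure ((2 : ℕ) : ℤ) v).map (galoisCohomology.map (φ.restrictField (Place.Completion v)) 1)
  have h𝓐 : ∀ v, 𝓐 v = (Wd.kummerSelmerStructure ((2 : ℕ) : ℤ) v).map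
      (galoisCohomology.map (φ.restrictField (Place.Completion v)) 1) := fun _ ↦ rfl
  -- agreement with `𝓚_W` at every place other than `v₀`, row by row
  have hagree : ∀ v : Place K, v ≠ Sum.inr v₀ → 𝓐 v = W.kummerSelmerStructure ((2 : ℕ) : ℤ) v := by
    rintro (w | v) hv
    · exact transport_twist_agree_inl_of_menu W φ ψ hφψ hsplit 𝓐 h𝓐 w (hinf w)
    · have hvv₀ : v ≠ v₀ := fun h ↦ hv (by rw [h])
      exact transport_twist_agree_inr_of_menu₅ W φ ψ hφψ hsplit hunr 𝓐 h𝓐 v (hfin v hvv₀)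
  exact ⟨φ, ψ, hψφ, hφψ, fun c hc hc0 ↦
    map_mem_selmer_of_localization_eq_zero W Wd 2 φ 𝓐 h𝓐 v₀ hagree hc hc0⟩

/-- **`#Sel₂(E) = 1` ⟹ THE STRICT PART OF `Sel₂(E^{(d)})` AT `v₀` IS ZERO** (same frame): a class `c ∈ Sel₂(Wd)` with
`loc_{v₀} c = 0` transports to `H¹(φ) c ∈ Sel₂(W) = 0`, and `H¹(ψ) ∘ H¹(φ) = id`. So when `Sel₂(E)` is trivial every non-zero
`2`-Selmer class of the twist is detected by its localisation at the one place `v₀` off the menu.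
[cite: MazurRubin2010, Prop. 3.3 (first display of the proof), Cor. 3.4 (i) (arXiv:0904.3709 p. 10)] -/
theorem twin_selmer_eq_zero_of_localization_eq_zero_of_natCard_eq_one_of_menu₅
    {d : K} (hd : d ≠ 0) {Wd : WeierstrassCurve K} [Wd.IsElliptic] {C : VariableChange K}
    (hWd : C • W.quadraticTwist d = Wd) (v₀ : HeightOneSpectrum (𝓞 K))
    (hfin : ∀ v : HeightOneSpectrum (𝓞 K), v ≠ v₀ →
      (∃ s : v.adicCompletion K, s ^ 2 = algebraMap K (v.adicCompletion K) d) ∨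
      (((2 : ℕ) : 𝓞 K) ∉ v.asIdeal ∧
        ¬ 2 ∣ (W.baseChange (v.adicCompletion K)).localTamagawaNumber (v.adicCompletionIntegers K) ∧
        ¬ 2 ∣ (Wd.baseChange (v.adicCompletion K)).localTamagawaNumber (v.adicCompletionIntegers K)) ∨
      (((2 : ℕ) : 𝓞 K) ∉ v.asIdeal ∧ W.HasGoodReductionAt v ∧ Wd.HasGoodReductionAt v) ∨
      (((2 : ℕ) : 𝓞 K) ∉ v.asIdeal ∧
        Nat.card (nsmulAddMonoidHom 2 : (W.baseChange (v.adicCompletion K)).toAffine.Point →+ _).ker = 1 ∧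
        Nat.card (nsmulAddMonoidHom 2 : (Wd.baseChange (v.adicCompletion K)).toAffine.Point →+ _).ker = 1) ∨
      ((W.HasGoodReductionAt v ∨ (W.HasMultiplicativeReductionAt v ∧ Odd (W.ordMinimalDiscriminant v))) ∧
        closureEmb (K := K) (v.adicCompletion K) (geomSqrt d) ∈ maxUnramified (v.adicCompletion K)))
    (hinf : ∀ w : InfinitePlace K,
      (∃ s : w.Completion, s ^ 2 = algebraMap K w.Completion d) ∨
      ((∀ x : galoisCohomology (W.localGaloisModule w.Completion) 1, x = 0) ∧
        (∀ x : galoisCohomology (Wd.localGaloisModule w.Completion) 1, x = 0)))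
    (h1 : Nat.card (W.selmerGroup ((2 : ℕ) : ℤ)) = 1)
    {c : galoisCohomology (Wd.torsionGaloisModule ((2 : ℕ) : ℤ)) 1}
    (hc : c ∈ (Wd.kummerSelmerStructure ((2 : ℕ) : ℤ)).selmerGroup)
    (hc0 : galoisCohomology.localization (Wd.torsionGaloisModule ((2 : ℕ) : ℤ)) (Sum.inr v₀) 1 c = 0) :
    c = 0 := by
  obtain ⟨φ, ψ, hψφ, -, hmap⟩ :=
    exists_intertwining_twin_selmer_map_mem_of_localization_eq_zero_of_menu₅ W hd hWd v₀ hfin hinf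
  obtain ⟨hmem, -⟩ := hmap c hc hc0
  have hmem' : galoisCohomology.map φ 1 c ∈ W.selmerGroup ((2 : ℕ) : ℤ) := by
    rw [selmerGroup_eq_selmerGroup_kummerSelmerStructure]
    exact hmem
  rw [AddSubgroup.card_eq_one.mp h1] at hmem'
  have h0 : galoisCohomology.map φ 1 c = 0 := AddSubgroup.mem_bot.mp hmem'
  rw [← map_map_eq_self_of_comp_eq φ ψ hψφ c, h0, map_zero]

/-- **POINT FORM over a number field (one `DecidableEq` instance throughout): if the strict-at-`v₀` part of `Sel₂(V)` is zero, a
point `P ∈ V(K) ∖ 2V(K)` is NOT halvable in `V(K_{v₀})`.** The Kummer class `κ(P) ∈ Sel₂(V)` is non-zero (`ker κ = 2V(K)`,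
`kummerMapTorsion_ker`), so `loc_{v₀} κ(P) ≠ 0`, and `loc_{v₀} κ(P) = 0 ⟺ P ∈ 2V(K_{v₀})` (`localization_kummerMapTorsion_eq_zero_iff`).
Stated over a general number field so that the group law on `V(K)` carries one `DecidableEq` instance (the lineage's convention,
`GenusKolyTransp.exists_kummerMapTorsion_ne_zero_of_rank_one`). [cite: SilvermanAEC2009, VIII §2 (Kummer sequence), X §4 diagram (**)] -/
theorem not_exists_two_smul_completion_of_forall_selmer_eq_zero (V : WeierstrassCurve K) [V.IsElliptic]
    (v₀ : HeightOneSpectrum (𝓞 K))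
    (hzero : ∀ c ∈ (V.kummerSelmerStructure ((2 : ℕ) : ℤ)).selmerGroup,
      galoisCohomology.localization (V.torsionGaloisModule ((2 : ℕ) : ℤ)) (Sum.inr v₀) 1 c = 0 → c = 0)
    (hdiv : ∀ P : geomPoints V, ∃ Q : geomPoints V, ((2 : ℕ) : ℤ) • Q = P)
    {P : V.toAffine.Point} (hP : ¬ ∃ Q : V.toAffine.Point, ((2 : ℕ) : ℤ) • Q = P) :
    ¬ ∃ R : (V.baseChange (Place.Completion (Sum.inr v₀ : Place K))).toAffine.Point,
      ((2 : ℕ) : ℤ) • R = Affine.Point.baseChange (W' := V) K (Place.Completion (Sum.inr v₀ : Place K)) P := by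
  haveI : PerfectField K := PerfectField.ofCharZero
  have h20 : ((2 : ℕ) : ℤ) ≠ 0 := by norm_num
  -- the Kummer class of `P` is a non-zero Selmer class
  have hκS : kummerMapTorsion V _ hdiv P ∈ (V.kummerSelmerStructure ((2 : ℕ) : ℤ)).selmerGroup :=
    (SetLike.ext_iff.mp (V.selmerGroup_eq_selmerGroup_kummerSelmerStructure _) _).mp
      (kummerMapTorsion_mem_selmerGroup V _ hdiv _)
  have hκ_ne : kummerMapTorsion V _ hdiv P ≠ 0 := by
    intro h0
    have hker : P ∈ (kummerMapTorsion V ((2 : ℕ) : ℤ) hdiv).ker := h0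
    rw [kummerMapTorsion_ker] at hker
    obtain ⟨Q, hQ⟩ := hker
    exact hP ⟨Q, hQ⟩
  intro hR
  exact hκ_ne (hzero _ hκS ((localization_kummerMapTorsion_eq_zero_iff V h20 hdiv (Sum.inr v₀) P).mpr hR))

end Menu

/-! ## §2 The `ℚ`-instance: Heegner twin, `Δ_W < 0`, odd `d_K`, silence off `v₀` -/

section Rat

variable (W : WeierstrassCurve ℚ) [W.IsElliptic] [W.IsGloballyMinimal]

/-- **CLAIM B, GLOBAL HALF, SELMER CURRENCY.** `W/ℚ` globally minimal elliptic with `Δ_W < 0`, `K` quadratic with odd `d_K`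
satisfying the Heegner hypothesis for `N_W`, `Wd` any elliptic model of `W^{(d_K)}`, `v₀` a finite place such that every prime of
`d_K` NOT under `v₀` is SILENT for both curves (`#W(ℚ_v)[2] = #Wd(ℚ_v)[2] = 1`; e.g. `d_K = −ℓ₀` prime, or `ord₂ c(Wd) ≤ 1` with `ℓ₀`
the transposition prime). IF `#Sel₂(W) = 1` THEN every `c ∈ Sel₂(Wd)` with `loc_{v₀} c = 0` is `0`. Place menu off `v₀`: primes of
`N_W` split (Heegner), `2 ∤ N_W` split or unramified-good, odd primes of `d_K` silent, the rest good for both; `∞`: `H¹ = 0` twice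
(`Δ_W < 0`, `Δ_{Wd} < 0`). Unconditional. [cite: MazurRubin2010, Prop. 3.3, Cor. 3.4 (i), Lemma 2.10 (arXiv:0904.3709 pp. 8–10)]
[cite: GrossLMS1991, §1 (p. 235)] -/
theorem twin_selmer_eq_zero_of_localization_eq_zero_of_selmerTrivial
    {K : Type} [Field K] [NumberField K] (hΔ : W.Δ < 0) (h2 : Module.finrank ℚ K = 2) (hodd : Odd (discr K))
    (hH : SatisfiesHeegnerHypothesis (W.conductorNorm ℤ) K) (v₀ : HeightOneSpectrum (𝓞 ℚ))
    {Wd : WeierstrassCurve ℚ} [Wd.IsElliptic] {C : VariableChange ℚ} (hC : C • W.quadraticTwist (discr K : ℚ) = Wd)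
    (hsil : ∀ v : HeightOneSpectrum (𝓞 ℚ), v ≠ v₀ → (((primesEquiv v : Nat.Primes) : ℕ) : ℤ) ∣ discr K →
      Nat.card (nsmulAddMonoidHom 2 : (W.baseChange (v.adicCompletion ℚ)).toAffine.Point →+ _).ker = 1 ∧
      Nat.card (nsmulAddMonoidHom 2 : (Wd.baseChange (v.adicCompletion ℚ)).toAffine.Point →+ _).ker = 1)
    (h1 : Nat.card (W.selmerGroup 2) = 1)
    {c : galoisCohomology (Wd.torsionGaloisModule ((2 : ℕ) : ℤ)) 1}
    (hc : c ∈ (Wd.kummerSelmerStructure ((2 : ℕ) : ℤ)).selmerGroup)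
    (hc0 : galoisCohomology.localization (Wd.torsionGaloisModule ((2 : ℕ) : ℤ)) (Sum.inr v₀) 1 c = 0) :
    c = 0 := by
  have hd0 : (discr K : ℚ) ≠ 0 := by
    intro h
    exact (Int.not_even_iff_odd.mpr hodd) (by rw [show discr K = 0 by exact_mod_cast h]; exact Even.zero)
  have h1' : Nat.card (W.selmerGroup ((2 : ℕ) : ℤ)) = 1 := h1
  exact twin_selmer_eq_zero_of_localization_eq_zero_of_natCard_eq_one_of_menu₅ W hd0 hC v₀
    (twist_place_menu₅_finite_rat_of_silent W h2 hodd hH v₀ hC hsil) (twist_place_menu_infinite_rat W hΔ hd0 hC) h1' hc hc0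

/-- **Every non-zero `2`-Selmer class of the twin is NON-STRICT at `v₀`** (same frame, contrapositive form): `#Sel₂(W) = 1`,
`c ∈ Sel₂(Wd)`, `c ≠ 0 ⟹ loc_{v₀} c ≠ 0`. [cite: MazurRubin2010, Prop. 3.3, Cor. 3.4 (i)] -/
theorem twin_selmer_localization_ne_zero_of_selmerTrivial
    {K : Type} [Field K] [NumberField K] (hΔ : W.Δ < 0) (h2 : Module.finrank ℚ K = 2) (hodd : Odd (discr K))
    (hH : SatisfiesHeegnerHypothesis (W.conductorNorm ℤ) K) (v₀ : HeightOneSpectrum (𝓞 ℚ))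
    {Wd : WeierstrassCurve ℚ} [Wd.IsElliptic] {C : VariableChange ℚ} (hC : C • W.quadraticTwist (discr K : ℚ) = Wd)
    (hsil : ∀ v : HeightOneSpectrum (𝓞 ℚ), v ≠ v₀ → (((primesEquiv v : Nat.Primes) : ℕ) : ℤ) ∣ discr K →
      Nat.card (nsmulAddMonoidHom 2 : (W.baseChange (v.adicCompletion ℚ)).toAffine.Point →+ _).ker = 1 ∧
      Nat.card (nsmulAddMonoidHom 2 : (Wd.baseChange (v.adicCompletion ℚ)).toAffine.Point →+ _).ker = 1)
    (h1 : Nat.card (W.selmerGroup 2) = 1)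
    {c : galoisCohomology (Wd.torsionGaloisModule ((2 : ℕ) : ℤ)) 1}
    (hc : c ∈ (Wd.kummerSelmerStructure ((2 : ℕ) : ℤ)).selmerGroup) (hc_ne : c ≠ 0) :
    galoisCohomology.localization (Wd.torsionGaloisModule ((2 : ℕ) : ℤ)) (Sum.inr v₀) 1 c ≠ 0 :=
  fun hc0 ↦ hc_ne (twin_selmer_eq_zero_of_localization_eq_zero_of_selmerTrivial W hΔ h2 hodd hH v₀ hC hsil h1 hc hc0)

/-- **CLAIM B, GLOBAL HALF, KUMMER-CLASS CURRENCY: the Kummer class of a twin point outside `2·Wd(ℚ)` is NON-STRICT at `v₀`,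
i.e. the point is NOT halvable in `Wd(ℚ_{v₀})`.** Same frame, `#Sel₂(W) = 1`; for `P ∈ Wd(ℚ)` with `κ(P) ≠ 0` (⟺ `P ∉ 2Wd(ℚ)`,
`kummerMapTorsion_ker`): there is no `R ∈ Wd(ℚ_{v₀})` with `2R = P` (`ℚ_{v₀}` = `Place.Completion (Sum.inr v₀)`). The hypothesis is
kept in Kummer-class form so that no group law on `Wd(ℚ)` is elaborated here (over `ℚ` two `DecidableEq` instances compete; the
point form `P ∉ 2Wd(ℚ)` is §1's `not_exists_two_smul_completion_of_forall_selmer_eq_zero`, fed with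
`twin_selmer_eq_zero_of_localization_eq_zero_of_selmerTrivial`). For the cell: `P = z`, the twin's point under `y_K − s ∈ E(K)⁻`;
«`M₀ = 0` ⟹ `z` off `2Wd(ℚ_{ℓ₀})`» (= singular reduction at the twisting prime, LEAD §2).
[cite: MazurRubin2010, Prop. 3.3, Cor. 3.4 (i)] [cite: SilvermanAEC2009, VIII §2 (Kummer sequence), X §4 diagram (**)] -/
theorem not_exists_two_smul_completion_of_kummer_ne_zero_of_selmerTrivial
    {K : Type} [Field K] [NumberField K] (hΔ : W.Δ < 0) (h2 : Module.finrank ℚ K = 2) (hodd : Odd (discr K))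
    (hH : SatisfiesHeegnerHypothesis (W.conductorNorm ℤ) K) (v₀ : HeightOneSpectrum (𝓞 ℚ))
    {Wd : WeierstrassCurve ℚ} [Wd.IsElliptic] {C : VariableChange ℚ} (hC : C • W.quadraticTwist (discr K : ℚ) = Wd)
    (hsil : ∀ v : HeightOneSpectrum (𝓞 ℚ), v ≠ v₀ → (((primesEquiv v : Nat.Primes) : ℕ) : ℤ) ∣ discr K →
      Nat.card (nsmulAddMonoidHom 2 : (W.baseChange (v.adicCompletion ℚ)).toAffine.Point →+ _).ker = 1 ∧
      Nat.card (nsmulAddMonoidHom 2 : (Wd.baseChange (v.adicCompletion ℚ)).toAffine.Point →+ _).ker = 1)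
    (h1 : Nat.card (W.selmerGroup 2) = 1)
    (P : Wd.toAffine.Point) (hκ : kummerMapTorsion Wd ((2 : ℕ) : ℤ) (hdiv_two Wd) P ≠ 0) :
    ¬ ∃ R : (Wd.baseChange (Place.Completion (Sum.inr v₀ : Place ℚ))).toAffine.Point,
      ((2 : ℕ) : ℤ) • R = Affine.Point.baseChange (W' := Wd) ℚ (Place.Completion (Sum.inr v₀ : Place ℚ)) P := by
  have h20 : ((2 : ℕ) : ℤ) ≠ 0 := by norm_num
  have hκS : kummerMapTorsion Wd _ (hdiv_two Wd) P ∈ (Wd.kummerSelmerStructure ((2 : ℕ) : ℤ)).selmerGroup :=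
    (SetLike.ext_iff.mp (Wd.selmerGroup_eq_selmerGroup_kummerSelmerStructure _) _).mp
      (kummerMapTorsion_mem_selmerGroup Wd _ (hdiv_two Wd) _)
  have hloc := twin_selmer_localization_ne_zero_of_selmerTrivial W hΔ h2 hodd hH v₀ hC hsil h1 hκS hκ
  rwa [Ne, localization_kummerMapTorsion_eq_zero_iff Wd h20 (hdiv_two Wd) (Sum.inr v₀) P] at hloc

/-- **The dichotomy packaged: on the `#Sel₂(W) = 1` cell, `P ∈ 2Wd(ℚ_{v₀}) ⟺ κ(P) = 0` (⟺ `P ∈ 2Wd(ℚ)`)** — ⟸ is the local Kummer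
sequence, ⟹ is Claim B. [cite: MazurRubin2010, Prop. 3.3, Cor. 3.4 (i)] [cite: SilvermanAEC2009, VIII §2, X §4] -/
theorem exists_two_smul_completion_iff_kummer_eq_zero_of_selmerTrivial
    {K : Type} [Field K] [NumberField K] (hΔ : W.Δ < 0) (h2 : Module.finrank ℚ K = 2) (hodd : Odd (discr K))
    (hH : SatisfiesHeegnerHypothesis (W.conductorNorm ℤ) K) (v₀ : HeightOneSpectrum (𝓞 ℚ))
    {Wd : WeierstrassCurve ℚ} [Wd.IsElliptic] {C : VariableChange ℚ} (hC : C • W.quadraticTwist (discr K : ℚ) = Wd)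
    (hsil : ∀ v : HeightOneSpectrum (𝓞 ℚ), v ≠ v₀ → (((primesEquiv v : Nat.Primes) : ℕ) : ℤ) ∣ discr K →
      Nat.card (nsmulAddMonoidHom 2 : (W.baseChange (v.adicCompletion ℚ)).toAffine.Point →+ _).ker = 1 ∧
      Nat.card (nsmulAddMonoidHom 2 : (Wd.baseChange (v.adicCompletion ℚ)).toAffine.Point →+ _).ker = 1)
    (h1 : Nat.card (W.selmerGroup 2) = 1) (P : Wd.toAffine.Point) :
    (∃ R : (Wd.baseChange (Place.Completion (Sum.inr v₀ : Place ℚ))).toAffine.Point,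
      ((2 : ℕ) : ℤ) • R = Affine.Point.baseChange (W' := Wd) ℚ (Place.Completion (Sum.inr v₀ : Place ℚ)) P) ↔
    kummerMapTorsion Wd ((2 : ℕ) : ℤ) (hdiv_two Wd) P = 0 := by
  have h20 : ((2 : ℕ) : ℤ) ≠ 0 := by norm_num
  refine ⟨fun h ↦ ?_, fun h0 ↦ ?_⟩
  · by_contra hκ
    exact not_exists_two_smul_completion_of_kummer_ne_zero_of_selmerTrivial W hΔ h2 hodd hH v₀ hC hsil h1 P hκ h
  · exact (localization_kummerMapTorsion_eq_zero_iff Wd h20 (hdiv_two Wd) (Sum.inr v₀) P).mp (by rw [h0]; exact map_zero _)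

end Rat

/-! ## §3 The prime Heegner field `d_K = −ℓ` (the supply's fields), also in `strictLocalKer` currency -/

section Prime

variable (W : WeierstrassCurve ℚ) [W.IsElliptic] [W.IsGloballyMinimal]

omit [W.IsElliptic] [W.IsGloballyMinimal] in
/-- For `d_K = −ℓ` (`ℓ` prime) the silence hypothesis off the place `v₀ ∋ ℓ` is VACUOUS: a finite place whose prime divides
`d_K = −ℓ` is `v₀`. [folklore] -/
theorem silent_off_of_discr_eq_neg_prime {K : Type} [Field K] [NumberField K] {ℓ : ℕ} (hℓ : ℓ.Prime)
    (hd : discr K = -(ℓ : ℤ)) {v₀ : HeightOneSpectrum (𝓞 ℚ)} (hv₀ : (ℓ : 𝓞 ℚ) ∈ v₀.asIdeal) (Wd : WeierstrassCurve ℚ) :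
    ∀ v : HeightOneSpectrum (𝓞 ℚ), v ≠ v₀ → (((primesEquiv v : Nat.Primes) : ℕ) : ℤ) ∣ discr K →
      Nat.card (nsmulAddMonoidHom 2 : (W.baseChange (v.adicCompletion ℚ)).toAffine.Point →+ _).ker = 1 ∧
      Nat.card (nsmulAddMonoidHom 2 : (Wd.baseChange (v.adicCompletion ℚ)).toAffine.Point →+ _).ker = 1 := by
  intro v hv hdvd
  exfalso
  apply hv
  rw [hd, Int.dvd_neg, Int.natCast_dvd_natCast] at hdvd
  have hp : ((primesEquiv v : Nat.Primes) : ℕ) = ℓ := (Nat.prime_dvd_prime_iff_eq (primesEquiv v).2 hℓ).mp hdvd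
  have hp₀ : ((primesEquiv v₀ : Nat.Primes) : ℕ) = ℓ := primesEquiv_eq hℓ hv₀
  exact primesEquiv.injective (Subtype.ext (hp.trans hp₀.symm))

/-- **CLAIM B for the PRIME Heegner twin, Selmer currency.** `W/ℚ` globally minimal elliptic, `Δ_W < 0`, `K` imaginary quadratic
with `d_K = −ℓ` (`ℓ` prime), Heegner for `N_W`, `Wd` any elliptic model of `W^{(d_K)}`, `v₀` the place over `ℓ`: `#Sel₂(W) = 1`,
`c ∈ Sel₂(Wd)`, `loc_{v₀} c = 0 ⟹ c = 0`. [cite: MazurRubin2010, Prop. 3.3, Cor. 3.4 (i)] [cite: GrossLMS1991, §1 (p. 235)] -/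
theorem twin_selmer_eq_zero_of_localization_eq_zero_of_selmerTrivial_prime
    {K : Type} [Field K] [NumberField K] (hΔ : W.Δ < 0) (hK : IsImaginaryQuadratic K)
    (hH : SatisfiesHeegnerHypothesis (W.conductorNorm ℤ) K) {ℓ : ℕ} (hℓ : ℓ.Prime) (hℓ2 : ℓ ≠ 2) (hd : discr K = -(ℓ : ℤ))
    {v₀ : HeightOneSpectrum (𝓞 ℚ)} (hv₀ : (ℓ : 𝓞 ℚ) ∈ v₀.asIdeal)
    {Wd : WeierstrassCurve ℚ} [Wd.IsElliptic] {C : VariableChange ℚ} (hC : C • W.quadraticTwist (discr K : ℚ) = Wd)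
    (h1 : Nat.card (W.selmerGroup 2) = 1)
    {c : galoisCohomology (Wd.torsionGaloisModule ((2 : ℕ) : ℤ)) 1}
    (hc : c ∈ (Wd.kummerSelmerStructure ((2 : ℕ) : ℤ)).selmerGroup)
    (hc0 : galoisCohomology.localization (Wd.torsionGaloisModule ((2 : ℕ) : ℤ)) (Sum.inr v₀) 1 c = 0) :
    c = 0 := by
  have hodd : Odd (discr K) := by
    rw [hd, odd_neg, ← Int.not_even_iff_odd, Int.even_coe_nat]
    exact fun h ↦ hℓ2 ((Nat.Prime.even_iff hℓ).mp h)
  exact twin_selmer_eq_zero_of_localization_eq_zero_of_selmerTrivial W hΔ hK.1 hodd hH v₀ hC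
    (silent_off_of_discr_eq_neg_prime W hℓ hd hv₀ Wd) h1 hc hc0

/-- **CLAIM B in Mazur–Rubin's `strictLocalKer` currency: `Sel₂(Wd) ⊓ strictLocalKer Wd ℚ_ℓ 2 = ⊥` on the `#Sel₂(W) = 1` cell**
(prime Heegner twin frame; the companion of the lineage's `natCard_selmerGroup_eq_two_mul_of_not_le_strictLocalKer` /
`natCard_selmerGroup_dvd_twin_of_le_strictLocalKer`, read on the TWIN). [cite: MazurRubin2010, Def. 3.1, Prop. 3.3, Cor. 3.4 (i)] -/
theorem twin_selmer_eq_zero_of_mem_strictLocalKer_of_selmerTrivial_prime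
    {K : Type} [Field K] [NumberField K] (hΔ : W.Δ < 0) (hK : IsImaginaryQuadratic K)
    (hH : SatisfiesHeegnerHypothesis (W.conductorNorm ℤ) K) {ℓ : ℕ} [Fact ℓ.Prime] (hℓ2 : ℓ ≠ 2) (hd : discr K = -(ℓ : ℤ))
    {Wd : WeierstrassCurve ℚ} [Wd.IsElliptic] {C : VariableChange ℚ} (hC : C • W.quadraticTwist (discr K : ℚ) = Wd)
    (h1 : Nat.card (W.selmerGroup 2) = 1)
    {c : galoisCohomology (Wd.torsionGaloisModule ((2 : ℕ) : ℤ)) 1} (hc : c ∈ Wd.selmerGroup 2)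
    (hcs : c ∈ MazurRubin2010.strictLocalKer Wd ℚ_[ℓ] 2) : c = 0 := by
  have hℓ : ℓ.Prime := Fact.out
  -- the place `v₀` of `ℚ` over `ℓ`
  obtain ⟨v₀, hv₀⟩ : ∃ v : HeightOneSpectrum (𝓞 ℚ), ((primesEquiv v : Nat.Primes) : ℕ) = ℓ :=
    ⟨primesEquiv.symm ⟨ℓ, hℓ⟩, by rw [Equiv.apply_symm_apply]⟩
  have hℓv₀ : (ℓ : 𝓞 ℚ) ∈ v₀.asIdeal := by
    rw [← hv₀]
    exact Rat.HeightOneSpectrum.natCast_natGenerator_mem v₀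
  have hc' : c ∈ (Wd.kummerSelmerStructure ((2 : ℕ) : ℤ)).selmerGroup := by
    rw [← selmerGroup_eq_selmerGroup_kummerSelmerStructure]
    exact hc
  have hcs' : c ∈ MazurRubin2010.strictLocalKer Wd ℚ_[ℓ] ((2 : ℕ) : ℤ) := hcs
  refine twin_selmer_eq_zero_of_localization_eq_zero_of_selmerTrivial_prime W hΔ hK hH hℓ hℓ2 hd hℓv₀ hC h1 hc' ?_
  apply localization_eq_zero_of_mem_strictLocalKer Wd v₀
  subst hv₀
  exact hcs'

/-- **CLAIM B for the PRIME Heegner twin, Kummer-class / local-point currency**: `#Sel₂(W) = 1`, `P ∈ Wd(ℚ)` with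
`κ(P) ≠ 0` (`P ∉ 2Wd(ℚ)`) ⟹ `P ∉ 2·Wd(ℚ_{v₀})`, `v₀ ∋ ℓ`. For the cell (LEAD §2–§3): the twin Heegner point `z` is `2`-primitive in
`Wd(ℚ)` (`M₀ = 0`) only if it is `2`-primitive in `Wd(ℚ_{ℓ₀})`, i.e. off the `2`-divisible subgroup `Wd⁰(ℚ_{ℓ₀})` — singular
reduction at the twisting prime. [cite: MazurRubin2010, Prop. 3.3, Cor. 3.4 (i)] [cite: SilvermanAEC2009, VIII §2, X §4] -/
theorem not_exists_two_smul_completion_of_kummer_ne_zero_of_selmerTrivial_prime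
    {K : Type} [Field K] [NumberField K] (hΔ : W.Δ < 0) (hK : IsImaginaryQuadratic K)
    (hH : SatisfiesHeegnerHypothesis (W.conductorNorm ℤ) K) {ℓ : ℕ} (hℓ : ℓ.Prime) (hℓ2 : ℓ ≠ 2) (hd : discr K = -(ℓ : ℤ))
    {v₀ : HeightOneSpectrum (𝓞 ℚ)} (hv₀ : (ℓ : 𝓞 ℚ) ∈ v₀.asIdeal)
    {Wd : WeierstrassCurve ℚ} [Wd.IsElliptic] {C : VariableChange ℚ} (hC : C • W.quadraticTwist (discr K : ℚ) = Wd)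
    (h1 : Nat.card (W.selmerGroup 2) = 1)
    (P : Wd.toAffine.Point) (hκ : kummerMapTorsion Wd ((2 : ℕ) : ℤ) (hdiv_two Wd) P ≠ 0) :
    ¬ ∃ R : (Wd.baseChange (Place.Completion (Sum.inr v₀ : Place ℚ))).toAffine.Point,
      ((2 : ℕ) : ℤ) • R = Affine.Point.baseChange (W' := Wd) ℚ (Place.Completion (Sum.inr v₀ : Place ℚ)) P := by
  have hodd : Odd (discr K) := by
    rw [hd, odd_neg, ← Int.not_even_iff_odd, Int.even_coe_nat]
    exact fun h ↦ hℓ2 ((Nat.Prime.even_iff hℓ).mp h)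
  exact not_exists_two_smul_completion_of_kummer_ne_zero_of_selmerTrivial W hΔ hK.1 hodd hH v₀ hC
    (silent_off_of_discr_eq_neg_prime W hℓ hd hv₀ Wd) h1 P hκ

end Prime

end Summit.BirchSwinnertonDyer.BirchSwinnertonDyer.Theorems.GenusSupplyNarrow.DepthZero

end
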